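import Literature.NumberTheory.Transcendental.AyoubPeriodSeries
import HarnessLib

/-!
# Ayoub's repaired Théorème 1.11 (`ayoub_integration_injective_localized`): the elementary case of `ϖ`-Laurent polynomials, proved

Sibling proofs file of `AyoubPeriodSeries.lean` (which it imports and does not modify; theorems
only, no definition, no named fact).

Source: J. Ayoub, *La version relative de la conjecture des périodes de Kontsevich–Zagier
revisitée* (`AyoubRelKZRevisited`), §1.1, Théorème 1.1 (b), Notation 1.9, Théorème 1.11.

The named fact `ayoub_integration_injective_localized` (Théorème 1.11: term-by-term integration
`𝒫†(k, σ) = 𝒫†,eff(k, σ)[(2πi)⁻¹] → ℂ((ϖ))` is injective, unpacked as: `∫ F = 0 ⟹ ∃ N, ∃ g` in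
variables disjoint from `F` with `∫ g = (2πi)^N` and `g • F ∈ ⟨(a), (b)⟩_k`) is Ayoub's main
analytic theorem; its printed proof is motivic ("le Théorème 1.11 … découle aussitôt des
Théorèmes 2.4 et 2.5", p. 10 of the note: Thm. 2.4 = injectivity of (13) from the torsor structure
of `Spec 𝒫^ϖ(F, σ)` under the relative motivic Galois group, Thm. 2.5 = Ann. of Math. 181 (2015)
Thm. 3.21, Prop. 3.22, Thm. 4.21 via nearby-cycle and rigid-analytic motives) and is not
available in Lean.  What IS elementary is recorded here:

* `single_one_mem_OanDagger`: the Laurent monomials `ϖ^r` lie in `𝒪†_{k-alg}(𝔻̄^∞)` (root of the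
  degree-one polynomial `ϖ^{(-r)⁺} Y - ϖ^{r⁺}`);
* `single_mem_anGenB`: `f ϖ^r` with `f ∈ 𝒪_{k-alg}(𝔻̄^∞)`, `∫ f = 0` is a type (b) generator
  (`ϖ^r` involves no variable `zᵢ`);
* `mem_kSpan_anGenerators_of_finite_support`,
  `ayoub_integration_injective_localized_of_finite_support`: for `F` of FINITE `ϖ`-support with
  `∫ F = 0` the conclusion of Théorème 1.11 holds with `N = 0`, `g = 1`, because
  `F = Σ_r f_r • ϖ^r` is a finite sum of type (b) generators.

So the content of Théorème 1.11 lies entirely in Laurent series of infinite `ϖ`-support (compare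
Remarque 1.17 of the note, and `ayoub_relativeKZ_revisited_finiteSupport` for the purely
algebraic Théorème 1.7).
-/

noncomputable section

namespace Literature.NumberTheory.Transcendental.AyoubRel

section FiniteSupport

variable {k : Type} [Field k] (σ : k →+* ℂ)

/-- `0 ∈ 𝒪_{k-alg}(𝔻̄^∞)` (root of `Y`). [folklore] -/
theorem zero_mem_Oan : (0 : CSeries) ∈ Oan σ :=
  ⟨⟨0, fun a _ => by simp⟩, ⟨2, one_lt_two, by simp [summable_zero]⟩,
    ⟨Polynomial.X, Polynomial.X_ne_zero, by simp⟩⟩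

omit [Field k] in
/-- The constants `0`, `1 ∈ ℂ[[z]]` involve no variable. [folklore] -/
theorem not_usesVar_one (i : ℕ) : ¬ UsesVar (1 : CSeries) i := by
  rintro ⟨a, ha, hne⟩
  apply hne
  rw [MvPowerSeries.coeff_one, if_neg]
  intro h0
  exact ha (by simp [h0])

omit [Field k] in
/-- The constant `0 ∈ ℂ[[z]]` involves no variable. [folklore] -/
theorem not_usesVar_zero (i : ℕ) : ¬ UsesVar (0 : CSeries) i := by
  rintro ⟨a, -, hne⟩
  exact hne (by simp)

/-- `ϖ ↦ ϖ` under `k[z][ϖ] → ℂ[[z]]((ϖ))`. [folklore] -/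
@[simp] theorem polyToCLaurent_X :
    polyToCLaurent σ Polynomial.X = HahnSeries.single (1 : ℤ) (1 : CSeries) := by
  simp [polyToCLaurent]

/-- Constants go to constants under `k[z][ϖ] → ℂ[[z]]((ϖ))`. [folklore] -/
@[simp] theorem polyToCLaurent_C (c : MvPolynomial ℕ k) :
    polyToCLaurent σ (Polynomial.C c) = HahnSeries.C (polyToCSeries σ c) := by
  simp [polyToCLaurent]

omit [Field k] in
/-- Coefficients of the Laurent monomial `ϖ^r`: `1` in degree `r`, `0` elsewhere. [folklore] -/
theorem coeff_single_one_mem (r n : ℤ) :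
    (HahnSeries.single r (1 : CSeries)).coeff n = 1 ∨
      (HahnSeries.single r (1 : CSeries)).coeff n = 0 := by
  by_cases h : n = r
  · subst h
    exact Or.inl (HahnSeries.coeff_single_same _ _)
  · exact Or.inr (HahnSeries.coeff_single_of_ne h)

/-- **The Laurent monomials `ϖ^r` lie in `𝒪†_{k-alg}(𝔻̄^∞)`**: coefficients `0, 1 ∈ 𝒪_{k-alg}(𝔻̄^∞)`,
and `ϖ^r` is a root of the non-zero degree-one polynomial `ϖ^{(-r)⁺} · Y - ϖ^{r⁺} ∈ k[z][ϖ][Y]`.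
[cite: AyoubRelKZRevisited, §1.1] -/
theorem single_one_mem_OanDagger (r : ℤ) :
    HahnSeries.single r (1 : CSeries) ∈ OanDagger σ := by
  refine ⟨fun n => ?_, ?_⟩
  · rcases coeff_single_one_mem r n with h | h
    · rw [h]; exact one_mem_Oan σ
    · rw [h]; exact zero_mem_Oan σ
  · refine ⟨Polynomial.C (Polynomial.X ^ (-r).toNat) * Polynomial.X -
      Polynomial.C (Polynomial.X ^ r.toNat), ?_, ?_⟩
    · intro h
      have h1 := congrArg (fun P : Polynomial (Polynomial (MvPolynomial ℕ k)) => P.coeff 1) h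
      simp only [Polynomial.coeff_sub, Polynomial.coeff_C_mul, Polynomial.coeff_X_one, mul_one,
        Polynomial.coeff_C, one_ne_zero, if_false, sub_zero, Polynomial.coeff_zero] at h1
      exact (Polynomial.monic_X_pow _).ne_zero h1
    · rw [Polynomial.eval₂_sub, Polynomial.eval₂_mul, Polynomial.eval₂_C, Polynomial.eval₂_X,
        Polynomial.eval₂_C, map_pow, map_pow, polyToCLaurent_X, HahnSeries.single_pow,
        HahnSeries.single_pow, HahnSeries.single_mul_single, one_pow, one_pow, mul_one, sub_eq_zero]
      have h : (-r).toNat • (1 : ℤ) + r = r.toNat • (1 : ℤ) := by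
        simp only [nsmul_eq_mul, mul_one]
        omega
      rw [h]

/-- `f ϖ^r = f • ϖ^r`. [folklore] -/
theorem single_eq_smul_single_one (r : ℤ) (f : CSeries) :
    HahnSeries.single r f = f • HahnSeries.single r (1 : CSeries) := by
  ext n
  rw [HahnSeries.coeff_smul]
  by_cases h : n = r
  · subst h
    simp
  · simp [HahnSeries.coeff_single_of_ne h]

omit [Field k] in
/-- The Laurent monomial `ϖ^r` involves no variable `zᵢ`. [folklore] -/
theorem not_usesVarL_single_one (r : ℤ) (i : ℕ) :
    ¬ UsesVarL (HahnSeries.single r (1 : CSeries)) i := by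
  rintro ⟨n, hn⟩
  rcases coeff_single_one_mem r n with h | h
  · rw [h] at hn; exact not_usesVar_one i hn
  · rw [h] at hn; exact not_usesVar_zero i hn

/-- A type (b) generator: `f ϖ^r` with `f ∈ 𝒪_{k-alg}(𝔻̄^∞)`, `∫ f = 0`.
[cite: AyoubRelKZRevisited, Théorème 1.1 (b)] -/
theorem single_mem_anGenB (r : ℤ) {f : CSeries} (hf : f ∈ Oan σ) (h0 : intC f = 0) :
    HahnSeries.single r f ∈ anGenB σ :=
  ⟨f, hf, h0, HahnSeries.single r 1, single_one_mem_OanDagger σ r,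
    fun i hi => not_usesVarL_single_one r i hi.2, single_eq_smul_single_one r f⟩

/-- `kSpan σ S` contains every finite sum of elements of `S` (coefficients `1 = σ 1`). [folklore] -/
theorem finset_sum_mem_kSpan {M : Type*} [AddCommGroup M] [Module ℂ M] (S : Set M) {ι : Type*}
    (t : Finset ι) (v : ι → M) (hv : ∀ i ∈ t, v i ∈ S) : ∑ i ∈ t, v i ∈ kSpan σ S := by
  classical
  refine ⟨t.card, fun _ => 1, fun j => v (t.equivFin.symm j), fun j => hv _ (t.equivFin.symm j).2,
    ?_⟩
  simp only [map_one, one_smul]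
  rw [← Finset.sum_coe_sort]
  exact (Equiv.sum_comp t.equivFin.symm (fun i : t => v i)).symm

omit [Field k] in
/-- A Laurent series with finite `ϖ`-support is the finite sum of its monomials. [folklore] -/
theorem laurent_eq_sum_single_of_finite {V : Type*} [AddCommGroup V] (F : LaurentSeries V)
    (hF : F.support.Finite) : F = ∑ n ∈ hF.toFinset, HahnSeries.single n (F.coeff n) := by
  classical
  ext m
  rw [HahnSeries.coeff_sum, Finset.sum_eq_single m]
  · rw [HahnSeries.coeff_single_same]
  · intro n _ hn
    exact HahnSeries.coeff_single_of_ne hn.symm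
  · intro hm
    rw [HahnSeries.coeff_single_same]
    by_contra h
    exact hm (hF.mem_toFinset.mpr h)

/-- **`ϖ`-Laurent polynomials with `∫ = 0` are sums of type (b) generators.** If
`F ∈ ℂ[[z]]((ϖ))` has finite `ϖ`-support, all coefficients in `𝒪_{k-alg}(𝔻̄^∞)` and term-by-term
integral `0`, then `F = Σ_r f_r • ϖ^r` lies in the `k`-span of the generators of Théorème 1.1
(indeed of the type (b) ones). [cite: AyoubRelKZRevisited, Théorème 1.1 (b)] -/
theorem mem_kSpan_anGenerators_of_finite_support (F : LaurentSeries CSeries)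
    (hF : F.support.Finite) (hc : ∀ r : ℤ, F.coeff r ∈ Oan σ) (h0 : intCLaurent F = 0) :
    F ∈ kSpan σ (anGenerators σ) := by
  have hint : ∀ r : ℤ, intC (F.coeff r) = 0 := fun r => by
    have := congrArg (fun G : LaurentSeries ℂ => G.coeff r) h0
    simpa using this
  rw [laurent_eq_sum_single_of_finite F hF]
  exact finset_sum_mem_kSpan σ _ _ _ fun r _ => Or.inr (single_mem_anGenB σ r (hc r) (hint r))

/-- **Ayoub, revisited note, Théorème 1.11 — the case of `ϖ`-Laurent polynomials, proved** (in the
shape of the named fact `ayoub_integration_injective_localized`, with `N = 0` and `g = 1`): for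
every field `k` of characteristic `0`, every complex embedding `σ` and every
`F ∈ 𝒪†_{k-alg}(𝔻̄^∞)` of finite `ϖ`-support with `∫ F = 0`, `1 • F = F` is a `k`-combination of
the generators (a), (b).  The general case (infinite `ϖ`-support) is the motivic theorem and stays
the named fact. [cite: AyoubRelKZRevisited, Théorème 1.11] -/
theorem ayoub_integration_injective_localized_of_finite_support
    (k : Type) [Field k] [CharZero k] (σ : k →+* ℂ)
    (F : LaurentSeries CSeries) (hF : F ∈ OanDagger σ) (hfin : F.support.Finite)
    (h0 : intCLaurent F = 0) :
    ∃ (N : ℕ) (g : CSeries), g ∈ Oan σ ∧ (∀ i, ¬ (UsesVar g i ∧ UsesVarL F i)) ∧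
      intC g = (2 * Real.pi * Complex.I) ^ N ∧ g • F ∈ kSpan σ (anGenerators σ) := by
  refine ⟨0, 1, one_mem_Oan σ, fun i hi => not_usesVar_one i hi.1, by simp, ?_⟩
  rw [one_smul]
  exact mem_kSpan_anGenerators_of_finite_support σ F hfin hF.1 h0

end FiniteSupport

end Literature.NumberTheory.Transcendental.AyoubRel
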